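import Literature.Geometry.Lorentzian.KerrRedShiftFlux
import Literature.Geometry.Lorentzian.KerrSchildKillingEnergy
import Summits.FinalStateConjecture.FinalStateConjecture.Theorems.ClusterCompletenessAdiabaticMultiKerrILEDTEnergyLeafCoercive

/-!
# Route ClusterCompleteness — crux `AdiabaticMultiKerrILED`, line `Sketch`:
# the signed boundary and weight terms of the `T`-energy identity

Helper file for the crux `stmt-FinalStateConjecture-14310` (line `Sketch`), stubs
`neg_sum_multiplierCurrent_timeField_mul_nonneg` (main),
`sum_fderiv_coneFactor_mul_multiplierCurrent_timeField_nonneg` and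
`sum_fderiv_horizonFactor_mul_multiplierCurrent_timeField_nonneg`: the three SIGNED terms of the
weighted `T`-energy identity (`T = ∂₀ = KerrSchild.timeField`, current
`KerrSchild.multiplierCurrent G T w`, `(J^T)^μ = (G dw)^μ ∂₀w − ½ δ^μ_0 G(dw, dw)`) for a
coefficient field of Kerr–Schild form `G = η⁻¹ − φ l ⊗ l` (`KerrSchild.inverseMetric φ l`, `l`
Minkowski-null with `η(l, ∂₀) = 1`, i.e. `l⁰ = −1`, `|l⃗| = 1`):

* `neg_sum_multiplierCurrent_timeField_mul_nonneg_of_causal` — the dominant energy condition for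
  the `T`-current, by explicit algebra: wherever `φ ≤ 1` (so that `T` is causal), for every
  conormal `n` with `n₀ > 0` which is `G`-causal, `|n⃗|² ≤ n₀² + φ (n₀ − l⃗·n⃗)²`, the flux
  `−∑_μ (J^T)^μ n_μ` is `≥ 0` — indeed `2 n₀ · (−∑_μ (J^T)^μ n_μ)` is a sum of squares
  (`tEnergyFlux_poly_nonneg`);
* `neg_sum_multiplierCurrent_timeField_mul_nonneg` (**the leaf term**): for `0 ≤ φ(x) < 1` and an
  admissible conormal `n = (1, −q)`, `|q| ≤ 1` (`Kerr.admissibleConormals`), `0 ≤ −∑_μ (J^T)^μ n_μ`;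
* `sum_fderiv_coneFactor_mul_multiplierCurrent_timeField_nonneg` (**the backward-cone factor**):
  for `W = χ ∘ u₁`, `χ = Real.smoothTransition`, `u₁ = Kerr.coneFn A c`, and `x⁰ < A`,
  `0 ≤ φ(x) < 1`: `0 ≤ ∑_μ ∂_μW (J^T)^μ` (`dW = −k ν`, `k ≥ 0`, `ν = (1, (x⃗ − c)/(A − x⁰))`
  admissible where `u₁ ≥ 0`, as in `Kerr.coneFactor_flux`);
* `sum_fderiv_horizonFactor_mul_multiplierCurrent_timeField_nonneg` (**the receding horizon
  factor**, `a = 0`): for `W = χ(u₂/ε − 1)`, `u₂ = Kerr.horizonFn M 0`, at a point of the exact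
  Schwarzschild region (`φ(x) = 2H(x)`, `l = ℓ♯`, `r > 2M`): `0 ≤ ∑_μ ∂_μW (J^T)^μ`
  (`dW = −k ν`, `k ≥ 0`, `ν = s dt* − dr`, `s = (r − 2M)/(2M) > 0`, causal by
  `Kerr.horizonCovector_causal`, as in `Kerr.redShift_horizonFactor_flux`).

These are the `T`-current analogues of `Kerr.neg_sum_redShiftCurrent_mul_nonneg`,
`Kerr.coneFactor_flux` and `Kerr.redShift_horizonFactor_flux`; the sign convention is that of
`KerrSchild.multiplierCurrent` (`(J^T)^0 = −`energy density), so the good signs read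
`0 ≤ −∑ (J^T)^μ n_μ` and `0 ≤ ∑ ∂_μW (J^T)^μ`. Hawking–Ellis 1973, §4.3 (dominant energy
condition); Dafermos–Rodnianski–Shlapentokh-Rothman arXiv:1402.7034, §2.3.2 (signs of the
boundary terms). [folklore]
-/

noncomputable section

-- the doubled `FinalStateConjecture.FinalStateConjecture` path component trips dupNamespace
set_option linter.dupNamespace false

open Set Filter
open scoped BigOperators Topology
open Literature.Geometry.Lorentzian

namespace Summit.FinalStateConjecture.FinalStateConjecture.Theorems

/-! ### The smooth step `χ = Real.smoothTransition` (local copies of private Literature facts) -/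

/-- `χ' ≥ 0` (`χ` is monotone). [folklore] -/
private theorem tEnergyFlux_deriv_smoothTransition_nonneg (s : ℝ) :
    0 ≤ deriv Real.smoothTransition s :=
  Real.smoothTransition.monotone.deriv_nonneg

/-- `χ` is differentiable, with derivative `χ'`. [folklore] -/
private theorem tEnergyFlux_hasDerivAt_smoothTransition (s : ℝ) :
    HasDerivAt Real.smoothTransition (deriv Real.smoothTransition s) s :=
  ((Real.smoothTransition.contDiffAt (n := 1)).differentiableAt (by simp)).hasDerivAt

/-- `χ ∘ f` vanishes identically near a point where `f < 0` (`f` continuous there), so its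
derivative vanishes at that point. [folklore] -/
private theorem tEnergyFlux_fderiv_smoothTransition_comp_eq_zero {f : E4 → ℝ} {x : E4}
    (hf : ContinuousAt f x) (hx : f x < 0) :
    fderiv ℝ (fun y ↦ Real.smoothTransition (f y)) x = 0 := by
  have hev : (fun y ↦ Real.smoothTransition (f y)) =ᶠ[𝓝 x] fun _ ↦ (0 : ℝ) := by
    filter_upwards [hf.eventually_lt continuousAt_const hx] with y hy
    exact Real.smoothTransition.zero_of_nonpos hy.le
  rw [hev.fderiv_eq]
  simp

/-! ### The flux polynomial of the `T`-current and its sign -/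

/-- **`2t × flux` is a sum of squares.** For `f ≤ 1`, `t > 0`, `|l⃗| = 1` and the causality
inequality `|n⃗|² ≤ t² + f (t − b)²` (`b = l⃗·n⃗`), the flux polynomial
`t (½(1 + f) p₀² + ½|p⃗|² − ½ f a²) − (n⃗·p⃗) p₀ + f a b p₀ − f b p₀²` (`a = l⃗·p⃗`) is `≥ 0`:
with `q⃗ = p⃗ − a l⃗`, `m⃗ = n⃗ − b l⃗`,
`2t · flux = (1 − f)(t a − b p₀)² + (t² + f (t − b)² − |n⃗|²) p₀² + |t q⃗ − p₀ m⃗|²`. [folklore] -/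
theorem tEnergyFlux_poly_nonneg {f t l₁ l₂ l₃ n₁ n₂ n₃ : ℝ} (p₀ p₁ p₂ p₃ : ℝ) (hf1 : f ≤ 1)
    (ht : 0 < t) (hL : l₁ ^ 2 + l₂ ^ 2 + l₃ ^ 2 = 1)
    (hN : n₁ ^ 2 + n₂ ^ 2 + n₃ ^ 2 ≤ t ^ 2 + f * (t - (l₁ * n₁ + l₂ * n₂ + l₃ * n₃)) ^ 2) :
    0 ≤ t * (2⁻¹ * (1 + f) * p₀ ^ 2 + 2⁻¹ * (p₁ ^ 2 + p₂ ^ 2 + p₃ ^ 2) -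
          2⁻¹ * f * (l₁ * p₁ + l₂ * p₂ + l₃ * p₃) ^ 2) -
        (n₁ * p₁ + n₂ * p₂ + n₃ * p₃) * p₀ +
        f * (l₁ * p₁ + l₂ * p₂ + l₃ * p₃) * (l₁ * n₁ + l₂ * n₂ + l₃ * n₃) * p₀ -
        f * (l₁ * n₁ + l₂ * n₂ + l₃ * n₃) * p₀ ^ 2 := by
  -- the sum-of-squares identity (a pure polynomial identity, with the defect of `|l⃗|² = 1`)
  have key : 2 * t * (t * (2⁻¹ * (1 + f) * p₀ ^ 2 + 2⁻¹ * (p₁ ^ 2 + p₂ ^ 2 + p₃ ^ 2) -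
          2⁻¹ * f * (l₁ * p₁ + l₂ * p₂ + l₃ * p₃) ^ 2) -
        (n₁ * p₁ + n₂ * p₂ + n₃ * p₃) * p₀ +
        f * (l₁ * p₁ + l₂ * p₂ + l₃ * p₃) * (l₁ * n₁ + l₂ * n₂ + l₃ * n₃) * p₀ -
        f * (l₁ * n₁ + l₂ * n₂ + l₃ * n₃) * p₀ ^ 2) =
      (1 - f) * (t * (l₁ * p₁ + l₂ * p₂ + l₃ * p₃) - (l₁ * n₁ + l₂ * n₂ + l₃ * n₃) * p₀) ^ 2 +
          (t ^ 2 + f * (t - (l₁ * n₁ + l₂ * n₂ + l₃ * n₃)) ^ 2 - (n₁ ^ 2 + n₂ ^ 2 + n₃ ^ 2)) *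
            p₀ ^ 2 +
          ((t * (p₁ - (l₁ * p₁ + l₂ * p₂ + l₃ * p₃) * l₁) -
                p₀ * (n₁ - (l₁ * n₁ + l₂ * n₂ + l₃ * n₃) * l₁)) ^ 2 +
              (t * (p₂ - (l₁ * p₁ + l₂ * p₂ + l₃ * p₃) * l₂) -
                p₀ * (n₂ - (l₁ * n₁ + l₂ * n₂ + l₃ * n₃) * l₂)) ^ 2 +
            (t * (p₃ - (l₁ * p₁ + l₂ * p₂ + l₃ * p₃) * l₃) -
                p₀ * (n₃ - (l₁ * n₁ + l₂ * n₂ + l₃ * n₃) * l₃)) ^ 2) +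
        (1 - (l₁ ^ 2 + l₂ ^ 2 + l₃ ^ 2)) *
          (t * (l₁ * p₁ + l₂ * p₂ + l₃ * p₃) - p₀ * (l₁ * n₁ + l₂ * n₂ + l₃ * n₃)) ^ 2 := by
    ring
  rw [hL, sub_self, zero_mul, add_zero] at key
  have hsos : 0 ≤ (1 - f) * (t * (l₁ * p₁ + l₂ * p₂ + l₃ * p₃) -
        (l₁ * n₁ + l₂ * n₂ + l₃ * n₃) * p₀) ^ 2 +
          (t ^ 2 + f * (t - (l₁ * n₁ + l₂ * n₂ + l₃ * n₃)) ^ 2 - (n₁ ^ 2 + n₂ ^ 2 + n₃ ^ 2)) *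
            p₀ ^ 2 +
          ((t * (p₁ - (l₁ * p₁ + l₂ * p₂ + l₃ * p₃) * l₁) -
                p₀ * (n₁ - (l₁ * n₁ + l₂ * n₂ + l₃ * n₃) * l₁)) ^ 2 +
              (t * (p₂ - (l₁ * p₁ + l₂ * p₂ + l₃ * p₃) * l₂) -
                p₀ * (n₂ - (l₁ * n₁ + l₂ * n₂ + l₃ * n₃) * l₂)) ^ 2 +
            (t * (p₃ - (l₁ * p₁ + l₂ * p₂ + l₃ * p₃) * l₃) -
                p₀ * (n₃ - (l₁ * n₁ + l₂ * n₂ + l₃ * n₃) * l₃)) ^ 2) :=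
    add_nonneg (add_nonneg (mul_nonneg (sub_nonneg.2 hf1) (sq_nonneg _))
      (mul_nonneg (sub_nonneg.2 hN) (sq_nonneg _))) (by positivity)
  rw [← key] at hsos
  -- `0 ≤ 2t · flux` with `t > 0`
  by_contra hneg
  have h2 := mul_neg_of_pos_of_neg (by positivity : (0 : ℝ) < 2 * t) (not_le.mp hneg)
  linarith

/-- **The `T`-energy flux through a conormal `n`, explicitly.** For the Kerr–Schild-form
coefficient field `G = η⁻¹ − φ l ⊗ l` with `l⁰ = −1` and the multiplier `T = ∂₀`, writing
`p_μ = ∂_μ w`, `a = l⃗·p⃗`, `b = l⃗·n⃗`: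
`−∑_μ (J^T)^μ n_μ = n₀ (½(1 + φ) p₀² + ½|p⃗|² − ½ φ a²) − (n⃗·p⃗) p₀ + φ a b p₀ − φ b p₀²`
(for `n₀ = 1` this is `neg_sum_multiplierCurrent_timeField_mul_eq` of the leaf-coercivity file).
[folklore] -/
theorem tEnergyFlux_neg_sum_multiplierCurrent_timeField_mul_eq (φ : E4 → ℝ) (l : E4 → E4)
    (w : E4 → ℝ) (x : E4) (n : Fin 4 → ℝ) (hl0 : l x 0 = -1) :
    -∑ μ, KerrSchild.multiplierCurrent (KerrSchild.inverseMetric φ l) KerrSchild.timeField w x μ *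
        n μ =
      n 0 * (2⁻¹ * (1 + φ x) * fderiv ℝ w x (E4.basisVector 0) ^ 2 +
          2⁻¹ * (fderiv ℝ w x (E4.basisVector 1) ^ 2 + fderiv ℝ w x (E4.basisVector 2) ^ 2 +
            fderiv ℝ w x (E4.basisVector 3) ^ 2) -
          2⁻¹ * φ x * (l x 1 * fderiv ℝ w x (E4.basisVector 1) +
            l x 2 * fderiv ℝ w x (E4.basisVector 2) + l x 3 * fderiv ℝ w x (E4.basisVector 3)) ^ 2) -
        (n 1 * fderiv ℝ w x (E4.basisVector 1) + n 2 * fderiv ℝ w x (E4.basisVector 2) +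
          n 3 * fderiv ℝ w x (E4.basisVector 3)) * fderiv ℝ w x (E4.basisVector 0) +
        φ x * (l x 1 * fderiv ℝ w x (E4.basisVector 1) + l x 2 * fderiv ℝ w x (E4.basisVector 2) +
            l x 3 * fderiv ℝ w x (E4.basisVector 3)) * (l x 1 * n 1 + l x 2 * n 2 + l x 3 * n 3) *
          fderiv ℝ w x (E4.basisVector 0) -
        φ x * (l x 1 * n 1 + l x 2 * n 2 + l x 3 * n 3) * fderiv ℝ w x (E4.basisVector 0) ^ 2 := by
  obtain ⟨p, hp⟩ : ∃ p : Fin 4 → ℝ, ∀ β, fderiv ℝ w x (E4.basisVector β) = p β := ⟨_, fun _ ↦ rfl⟩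
  simp only [KerrSchild.multiplierCurrent, KerrSchild.inverseMetric, KerrSchild.timeField,
    Kerr.etaComp, hp, hl0, Fin.sum_univ_four, Fin.isValue]
  simp only [show (1 : Fin 4) ≠ 0 from by decide, show (2 : Fin 4) ≠ 0 from by decide,
    show (3 : Fin 4) ≠ 0 from by decide, show (0 : Fin 4) ≠ 1 from by decide,
    show (0 : Fin 4) ≠ 2 from by decide, show (0 : Fin 4) ≠ 3 from by decide,
    show (1 : Fin 4) ≠ 2 from by decide, show (1 : Fin 4) ≠ 3 from by decide,
    show (2 : Fin 4) ≠ 1 from by decide, show (2 : Fin 4) ≠ 3 from by decide,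
    show (3 : Fin 4) ≠ 1 from by decide, show (3 : Fin 4) ≠ 2 from by decide,
    if_true, if_false]
  ring

/-- **The dominant energy condition for the `T`-current, pointwise and explicit.** Let
`G = η⁻¹ − φ l ⊗ l` with `l⁰(x) = −1`, `|l⃗(x)| = 1` and `φ(x) ≤ 1` (so that `T = ∂₀` is causal at
`x`: `g(T, T) = −(1 − φ)`), and let `n` be a conormal with `n₀ > 0` which is `G(x)`-causal,
`G(n, n) = −n₀² + |n⃗|² − φ (l·n)² ≤ 0`, i.e. `|n⃗|² ≤ n₀² + φ (n₀ − l⃗·n⃗)²`. Then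
`0 ≤ −∑_μ (J^T)^μ(x) n_μ` for every `w` — the energy of `T` through a hypersurface element with
future causal conormal is non-negative (Hawking–Ellis 1973, §4.3; DRSR arXiv:1402.7034, §2.3.2),
here by the sum-of-squares identity `tEnergyFlux_poly_nonneg`. [folklore] -/
theorem neg_sum_multiplierCurrent_timeField_mul_nonneg_of_causal (φ : E4 → ℝ) (l : E4 → E4)
    (w : E4 → ℝ) (x : E4) (n : Fin 4 → ℝ) (hφ1 : φ x ≤ 1) (hl0 : l x 0 = -1)
    (hL : l x 1 ^ 2 + l x 2 ^ 2 + l x 3 ^ 2 = 1) (hn0 : 0 < n 0)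
    (hn : n 1 ^ 2 + n 2 ^ 2 + n 3 ^ 2 ≤
      n 0 ^ 2 + φ x * (n 0 - (l x 1 * n 1 + l x 2 * n 2 + l x 3 * n 3)) ^ 2) :
    0 ≤ -∑ μ, KerrSchild.multiplierCurrent (KerrSchild.inverseMetric φ l) KerrSchild.timeField w x
      μ * n μ := by
  rw [tEnergyFlux_neg_sum_multiplierCurrent_timeField_mul_eq φ l w x n hl0]
  exact tEnergyFlux_poly_nonneg _ _ _ _ hφ1 hn0 hL hn

/-! ### The registered stubs -/

/-- **The leaf term: the `T`-energy through an admissible leaf is non-negative off the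
ergoregion.** For a Kerr–Schild-form coefficient field `G = η⁻¹ − φ l ⊗ l` (`l` null,
`η(l, ∂₀) = 1`), a point with `0 ≤ φ(x) < 1` (where `T = ∂₀` is timelike), an admissible conormal
`n = (1, −q)`, `|q| ≤ 1` (the conormal of a leaf `{x⁰ = s + F(x⃗)}`, `‖∇F‖ ≤ 1`; such `n` are
`G`-causal since `φ ≥ 0`) and every `w`: `0 ≤ −∑_μ (J^T)^μ(x) n_μ` (DRSR arXiv:1402.7034, §2.3.2,
the sign of `J^T_μ n^μ_Σ`; the `T`-analogue of `Kerr.neg_sum_redShiftCurrent_mul_nonneg`).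
[folklore] -/
theorem neg_sum_multiplierCurrent_timeField_mul_nonneg : ∀ (φ : E4 → ℝ) (l : E4 → E4) (w : E4 → ℝ) (x : E4) (n : Fin 4 → ℝ), 0 ≤ φ x → φ x < 1 → Minkowski.bilin (l x) (l x) = 0 → Minkowski.bilin (l x) (E4.basisVector 0) = 1 → n ∈ Kerr.admissibleConormals → 0 ≤ -∑ μ, KerrSchild.multiplierCurrent (KerrSchild.inverseMetric φ l) KerrSchild.timeField w x μ * n μ := by
  intro φ l w x n hφ0 hφ1 hnull hnorm hn
  obtain ⟨hl0, hL⟩ := tEnergyLeaf_null_normalised_components hnull hnorm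
  obtain ⟨hn0, hN⟩ := hn
  rw [tEnergyLeaf_sum_sq_succ] at hN
  refine neg_sum_multiplierCurrent_timeField_mul_nonneg_of_causal φ l w x n hφ1.le hl0 hL
    (by rw [hn0]; exact one_pos) ?_
  rw [hn0]
  nlinarith [mul_nonneg hφ0 (sq_nonneg (1 - (l x 1 * n 1 + l x 2 * n 2 + l x 3 * n 3)))]

/-- **The backward-cone factor term has the good sign.** For a Kerr–Schild-form coefficient field
`G = η⁻¹ − φ l ⊗ l` (`l` null, `η(l, ∂₀) = 1`), a point with `x⁰ < A` and `0 ≤ φ(x) < 1`, and the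
smoothed indicator `W = χ ∘ u₁` of the solid backward cone (`χ = Real.smoothTransition`,
`u₁ = Kerr.coneFn A c`): `0 ≤ ∑_μ ∂_μW(x) (J^T)^μ(x)`. Where `u₁(x) < 0` the factor is locally
constant; where `u₁(x) ≥ 0`, `dW = −2χ'(u₁)(A − x⁰) ν` with `ν = (1, (x⃗ − c)/(A − x⁰))` an
admissible conormal (`|x⃗ − c| ≤ A − x⁰`), and the leaf term
`neg_sum_multiplierCurrent_timeField_mul_nonneg` gives the sign (Hawking–Ellis 1973, §4.3,
Lemma 4.3.1; the `T`-analogue of `Kerr.coneFactor_flux`, with the opposite overall sign because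
`(J^T)^0` is minus the energy density). [folklore] -/
theorem sum_fderiv_coneFactor_mul_multiplierCurrent_timeField_nonneg : ∀ (φ : E4 → ℝ) (l : E4 → E4) (w : E4 → ℝ) (A : ℝ) (c : E3) (x : E4), x 0 < A → 0 ≤ φ x → φ x < 1 → Minkowski.bilin (l x) (l x) = 0 → Minkowski.bilin (l x) (E4.basisVector 0) = 1 → 0 ≤ ∑ μ, fderiv ℝ (fun y ↦ Real.smoothTransition (Kerr.coneFn A c y)) x (E4.basisVector μ) * KerrSchild.multiplierCurrent (KerrSchild.inverseMetric φ l) KerrSchild.timeField w x μ := by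
  intro φ l w A c x hxA hφ0 hφ1 hnull hnorm
  rcases lt_or_ge (Kerr.coneFn A c x) 0 with hneg | hnn
  · rw [tEnergyFlux_fderiv_smoothTransition_comp_eq_zero (Kerr.continuous_coneFn A c).continuousAt
      hneg]
    simp
  · have hAx : 0 < A - x 0 := sub_pos.mpr hxA
    -- the conormal `ν = dt* + n⃗·dy⃗`, `n⃗ = (x⃗ − c)/(A − x⁰)`
    set ν : Fin 4 → ℝ := ![1, (E4.spatial x - c) 0 / (A - x 0), (E4.spatial x - c) 1 / (A - x 0),
      (E4.spatial x - c) 2 / (A - x 0)] with hν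
    have hν0 : ν 0 = 1 := rfl
    have hν1 : ν 1 = (E4.spatial x - c) 0 / (A - x 0) := rfl
    have hν2 : ν 2 = (E4.spatial x - c) 1 / (A - x 0) := rfl
    have hν3 : ν 3 = (E4.spatial x - c) 2 / (A - x 0) := rfl
    have hn : ν 1 ^ 2 + ν 2 ^ 2 + ν 3 ^ 2 ≤ 1 := by
      rw [hν1, hν2, hν3, div_pow, div_pow, div_pow, ← add_div, ← add_div,
        div_le_one (by positivity), ← E3.norm_sq]
      have : 0 ≤ (A - x 0) ^ 2 - ‖E4.spatial x - c‖ ^ 2 := hnn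
      linarith
    have hadm : ν ∈ Kerr.admissibleConormals := ⟨hν0, by rw [tEnergyLeaf_sum_sq_succ]; exact hn⟩
    have hflux := neg_sum_multiplierCurrent_timeField_mul_nonneg φ l w x ν hφ0 hφ1 hnull hnorm hadm
    -- the derivative of the factor is `−k ν`, `k ≥ 0`
    have hdiff : HasFDerivAt (Kerr.coneFn A c) (fderiv ℝ (Kerr.coneFn A c) x) x :=
      ((Kerr.contDiff_coneFn A c (n := 1)).differentiable (by simp) x).hasFDerivAt
    have hd : HasFDerivAt (fun y ↦ Real.smoothTransition (Kerr.coneFn A c y))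
        (deriv Real.smoothTransition (Kerr.coneFn A c x) • fderiv ℝ (Kerr.coneFn A c) x) x :=
      (tEnergyFlux_hasDerivAt_smoothTransition _).comp_hasFDerivAt x hdiff
    set k : ℝ := 2 * deriv Real.smoothTransition (Kerr.coneFn A c x) * (A - x 0) with hk
    have hk0 : 0 ≤ k :=
      mul_nonneg (mul_nonneg zero_le_two (tEnergyFlux_deriv_smoothTransition_nonneg _)) hAx.le
    have e0 : fderiv ℝ (fun y ↦ Real.smoothTransition (Kerr.coneFn A c y)) x (E4.basisVector 0) =
        -(k * ν 0) := by
      rw [hd.fderiv, FunLike.coe_smul, Pi.smul_apply, smul_eq_mul,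
        Kerr.fderiv_coneFn_basisVector_zero, hν0, hk]
      ring
    have es : ∀ i : Fin 3, fderiv ℝ (fun y ↦ Real.smoothTransition (Kerr.coneFn A c y)) x
        (E4.basisVector i.succ) = -(k * ((E4.spatial x - c) i / (A - x 0))) := by
      intro i
      rw [hd.fderiv, FunLike.coe_smul, Pi.smul_apply, smul_eq_mul,
        Kerr.fderiv_coneFn_basisVector_succ, hk]
      field_simp
    have e1 : fderiv ℝ (fun y ↦ Real.smoothTransition (Kerr.coneFn A c y)) x (E4.basisVector 1) =
        -(k * ν 1) := by rw [hν1]; exact es 0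
    have e2 : fderiv ℝ (fun y ↦ Real.smoothTransition (Kerr.coneFn A c y)) x (E4.basisVector 2) =
        -(k * ν 2) := by rw [hν2]; exact es 1
    have e3 : fderiv ℝ (fun y ↦ Real.smoothTransition (Kerr.coneFn A c y)) x (E4.basisVector 3) =
        -(k * ν 3) := by rw [hν3]; exact es 2
    rw [Fin.sum_univ_four] at hflux ⊢
    rw [e0, e1, e2, e3]
    have hkf := mul_nonneg hk0 hflux
    linarith

/-- **The receding horizon factor term has the good sign** (`a = 0`). At a point of the exact
Schwarzschild region of the zone (`φ(x) = 2H(x) = 2M/r`, `l = ℓ♯`, `r > 2M = r₊`, `M > 0`), for the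
smoothed indicator `W = χ(u₂/ε − 1)` (`χ = Real.smoothTransition`, `u₂ = Kerr.horizonFn M 0`,
`ε > 0`) and every `w`: `0 ≤ ∑_μ ∂_μW(x) (J^T)^μ(x)`. Indeed `dW = −k ν` with `k ≥ 0` and
`ν = s dt* − dr`, `s = (r − 2M)/(2M) > 0`, a causal covector (`Kerr.horizonCovector_causal`:
`Δ = r(r − 2M) ≤ 4Mrs = 2r(r − 2M)`) with `ν(T) = s > 0`, and `T` is timelike there
(`2M/r < 1`), so `−∑_μ (J^T)^μ ν_μ ≥ 0` by the dominant energy condition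
(`neg_sum_multiplierCurrent_timeField_mul_nonneg_of_causal`). DRSR arXiv:1402.7034, §2.3.2 (the
horizon flux of `J^T` is non-negative); the `T`-analogue of `Kerr.redShift_horizonFactor_flux`.
[folklore] -/
theorem sum_fderiv_horizonFactor_mul_multiplierCurrent_timeField_nonneg : ∀ (M : ℝ) (φ : E4 → ℝ) (w : E4 → ℝ) (ε : ℝ) (x : E4), 0 < M → 0 < ε → 2 * M < Kerr.radius 0 x → φ x = 2 * Kerr.scalarH M 0 x → 0 ≤ ∑ μ, fderiv ℝ (fun y ↦ Real.smoothTransition (Kerr.horizonFn M 0 y / ε - 1)) x (E4.basisVector μ) * KerrSchild.multiplierCurrent (KerrSchild.inverseMetric φ (Kerr.nullVector 0)) KerrSchild.timeField w x μ := by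
  intro M φ w ε x hM hε hx hφ
  have hxpos : 0 < Kerr.radius 0 x := lt_trans (by positivity) hx
  have hrp : Kerr.rPlus M 0 = 2 * M := Kerr.rPlus_zero_right hM.le
  -- the conormal `ν = s dt* − dr`, `s = (r − 2M)/(2M) > 0`
  set s : ℝ := (2 * M)⁻¹ * (Kerr.radius 0 x - 2 * M) with hs
  have hs0 : 0 < s := mul_pos (by positivity) (by linarith)
  have hΔ : Kerr.radius 0 x ^ 2 - 2 * M * Kerr.radius 0 x + 0 ^ 2 ≤
      4 * M * Kerr.radius 0 x * s := by
    have h2 : 4 * M * Kerr.radius 0 x * s = 2 * (Kerr.radius 0 x * (Kerr.radius 0 x - 2 * M)) := by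
      rw [hs]
      field_simp
      ring
    rw [h2]
    nlinarith [mul_nonneg hxpos.le (sub_nonneg.mpr hx.le)]
  set ν : Fin 4 → ℝ := ![s, -Kerr.radiusGradVec 0 (E4.spatial x) 0,
    -Kerr.radiusGradVec 0 (E4.spatial x) 1, -Kerr.radiusGradVec 0 (E4.spatial x) 2] with hν
  have hν0 : ν 0 = s := rfl
  obtain ⟨hcausal, -⟩ := Kerr.horizonCovector_causal hM.le hxpos hφ hs0.le hΔ ν rfl rfl rfl rfl
  -- the Kerr–Schild data at `x`: `l⁰ = −1`, `|l⃗| = 1`, `φ = 2M/r ≤ 1`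
  have hl0 : Kerr.nullVector 0 x 0 = -1 := Kerr.nullVector_apply_zero 0 x
  have hL : Kerr.nullVector 0 x 1 ^ 2 + Kerr.nullVector 0 x 2 ^ 2 + Kerr.nullVector 0 x 3 ^ 2 = 1 := by
    rw [Kerr.nullVector_apply_one, Kerr.nullVector_apply_two, Kerr.nullVector_apply_three]
    exact Kerr.sum_sq_nullCovectorFun hxpos
  have hH : Kerr.scalarH M 0 x = M / Kerr.radius 0 x := by
    unfold Kerr.scalarH
    rw [show (0 : ℝ) ^ 2 * x 3 ^ 2 = 0 by ring, add_zero,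
      div_eq_div_iff (pow_ne_zero 4 hxpos.ne') hxpos.ne']
    ring
  have hφ1 : φ x ≤ 1 := by
    rw [hφ, hH, ← mul_div_assoc, div_le_one hxpos]
    linarith
  -- `ν` is causal: `|ν⃗|² ≤ s² + φ (s − ℓ⃗·ν⃗)²`
  have hn : ν 1 ^ 2 + ν 2 ^ 2 + ν 3 ^ 2 ≤ ν 0 ^ 2 + φ x *
      (ν 0 - (Kerr.nullVector 0 x 1 * ν 1 + Kerr.nullVector 0 x 2 * ν 2 +
        Kerr.nullVector 0 x 3 * ν 3)) ^ 2 := by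
    simp only [KerrSchild.inverseMetric, Kerr.etaComp, Fin.sum_univ_four, Fin.isValue, hl0] at hcausal
    simp only [show (1 : Fin 4) ≠ 0 from by decide, show (2 : Fin 4) ≠ 0 from by decide,
      show (3 : Fin 4) ≠ 0 from by decide, show (0 : Fin 4) ≠ 1 from by decide,
      show (0 : Fin 4) ≠ 2 from by decide, show (0 : Fin 4) ≠ 3 from by decide,
      show (1 : Fin 4) ≠ 2 from by decide, show (1 : Fin 4) ≠ 3 from by decide,
      show (2 : Fin 4) ≠ 1 from by decide, show (2 : Fin 4) ≠ 3 from by decide,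
      show (3 : Fin 4) ≠ 1 from by decide, show (3 : Fin 4) ≠ 2 from by decide,
      if_true, if_false] at hcausal
    nlinarith [hcausal]
  -- the dominant energy condition: `0 ≤ −∑ (J^T)^μ ν_μ`
  have hflux := neg_sum_multiplierCurrent_timeField_mul_nonneg_of_causal φ (Kerr.nullVector 0) w x
    ν hφ1 hl0 hL (by rw [hν0]; exact hs0) hn
  -- the derivative of the factor is `−k ν`, `k ≥ 0` (as in `Kerr.horizonFactor_flux`)
  have hdiff : HasFDerivAt (Kerr.horizonFn M 0) (fderiv ℝ (Kerr.horizonFn M 0) x) x :=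
    ((Kerr.contDiffAt_horizonFn M hxpos (n := 1)).differentiableAt (by simp)).hasFDerivAt
  have haff : HasDerivAt (fun u : ℝ ↦ u / ε - 1) (1 / ε) (Kerr.horizonFn M 0 x) :=
    ((hasDerivAt_id _).div_const ε).sub_const 1
  have hd : HasFDerivAt (fun y ↦ Real.smoothTransition (Kerr.horizonFn M 0 y / ε - 1))
      ((deriv Real.smoothTransition (Kerr.horizonFn M 0 x / ε - 1) * (1 / ε)) •
        fderiv ℝ (Kerr.horizonFn M 0) x) x :=
    ((tEnergyFlux_hasDerivAt_smoothTransition _).comp _ haff).comp_hasFDerivAt x hdiff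
  set k : ℝ := deriv Real.smoothTransition (Kerr.horizonFn M 0 x / ε - 1) * (1 / ε) *
    Real.exp (-((2 * M)⁻¹ * x 0)) with hk
  have hk0 : 0 ≤ k :=
    mul_nonneg (mul_nonneg (tEnergyFlux_deriv_smoothTransition_nonneg _) (by positivity))
      (Real.exp_pos _).le
  have e0 : fderiv ℝ (fun y ↦ Real.smoothTransition (Kerr.horizonFn M 0 y / ε - 1)) x
      (E4.basisVector 0) = -(k * ν 0) := by
    rw [hd.fderiv, FunLike.coe_smul, Pi.smul_apply, smul_eq_mul,
      Kerr.fderiv_horizonFn_basisVector_zero hxpos, hrp, hν0, hk, hs]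
    ring
  have es : ∀ i : Fin 3, fderiv ℝ (fun y ↦ Real.smoothTransition (Kerr.horizonFn M 0 y / ε - 1)) x
      (E4.basisVector i.succ) = -(k * -Kerr.radiusGradVec 0 (E4.spatial x) i) := by
    intro i
    rw [hd.fderiv, FunLike.coe_smul, Pi.smul_apply, smul_eq_mul,
      Kerr.fderiv_horizonFn_basisVector_succ hxpos, hk]
    ring
  have e1 : fderiv ℝ (fun y ↦ Real.smoothTransition (Kerr.horizonFn M 0 y / ε - 1)) x
      (E4.basisVector 1) = -(k * ν 1) := es 0
  have e2 : fderiv ℝ (fun y ↦ Real.smoothTransition (Kerr.horizonFn M 0 y / ε - 1)) x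
      (E4.basisVector 2) = -(k * ν 2) := es 1
  have e3 : fderiv ℝ (fun y ↦ Real.smoothTransition (Kerr.horizonFn M 0 y / ε - 1)) x
      (E4.basisVector 3) = -(k * ν 3) := es 2
  rw [Fin.sum_univ_four] at hflux ⊢
  rw [e0, e1, e2, e3]
  have hkf := mul_nonneg hk0 hflux
  linarith

end Summit.FinalStateConjecture.FinalStateConjecture.Theorems
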